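import Literature.NumberTheory.Automorphic.ArchDiagonalTorus     -- ★ D1′b (p06): `archDiagTorus`, `continuous_archDiagTorus`, `isRegularElt_archDiagTorus_iff`
import Mathlib.Topology.Perfect
import HarnessLib

/-!
# The regular torus points are OPEN-DENSE in the diagonal torus; every torus point is a limit of regular torus points (road D1′ ∕ «D2′b»)
# (Rogawski 1990 §8.2 p. 122 «as `ψ → 0`»; §14.5 p. 238 «let `γ′` approach `γ₀` within `T″`»)

Topic `NumberTheory/Automorphic`; namespaces `Literature.Topology` (§§1–3, generic) and `Literature.NumberTheory.Automorphic.UnitaryGroup` (§4).  THEOREMS ONLY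
(no definition, no named fact, no instance — `PerfectSpace Circle` is stated as a THEOREM for `haveI` — no notation, no `sorry`).  Cell `hodgecm-mathlib`, floor-1
prep under #88 (ST-∞) ∕ #111 (S-d), CENSUS-D2prime-HClimit: the letters (L-H)∕(L-st) and every «`γ → γ₀` through regular `γ`» clause are limits ALONG THE FILTER
`𝓝[T_reg] γ₀` at a SINGULAR (or central) torus point `γ₀`; for such a `Tendsto` statement to carry content the filter must be proper — `γ₀ ∈ closure T_reg`.
This file proves it: in circle coordinates `z : W → Fin N → S¹` (★ D1′b `archDiagTorus L N α z`; regular ⇔ every `z w` injective, ★ `isRegularElt_archDiagTorus_iff`)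
the regular parameters are open and DENSE, and the image filter on `U(diag α)(L⁺ ⊗ ℝ)` is proper at every torus point.

* §1 (generic: `ι` finite, `X` Hausdorff without isolated points) `isClosed_setOf_apply_eq`, `interior_setOf_apply_eq`, `isOpen_setOf_injective`,
  **`dense_setOf_injective : Dense {z : ι → X | Injective z}`** (finite intersection of open dense sets — no Baire category).
* §2 `perfectSpace_circle : PerfectSpace Circle` (`x · e^{i∕(n+1)} → x`, `≠ x`).
* §3 `isOpen_setOf_forall_injective`, **`dense_setOf_forall_injective : Dense {z : W → ι → Circle | ∀ w, Injective (z w)}`**, `nhdsWithin_setOf_forall_injective_neBot`.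
* §4 **`UnitaryGroup.nhdsWithin_regular_archDiagTorus_neBot`** — at EVERY torus point `t(z₀)` of `U(diag α)(L⁺ ⊗ ℝ)` the filter
  `𝓝[{t(z) | z regular}] (t(z₀))` is proper (★ `continuous_archDiagTorus`).

JUNK AUDIT: no hypothesis on `α` (density is a statement about the torus parametrisation, not about the form); `W`, `ι` finite (for `ι` infinite and `X = S¹` there are
no injective maps at all when `ι` is uncountable — the finiteness is used); `N = 0, 1`: every point regular, statements trivial.
HONEST LABEL: HC_CM is proved only modulo the printed citations until rung 0 closes; count-neutral floor-1 preparation (topology only).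

## References
* J. D. Rogawski, *Automorphic Representations of Unitary Groups in Three Variables*, Ann. of Math. Stud. 123 (1990), §8.2 p. 122, §14.5 p. 238 [Rogawski1990].
* Th. Bröcker, T. tom Dieck, *Representations of Compact Lie Groups*, GTM 98 (1985), Ch. IV (2.11)–(3.1) (regular elements are dense in a maximal torus) [BrockerTomDieck1985].
-/

set_option autoImplicit false

noncomputable section

open Filter Topology Set Function

/-! ## §1 Injective maps from a finite type into a Hausdorff space without isolated points are open-dense -/

namespace Literature.Topology

variable {ι : Type*} {X : Type*} [TopologicalSpace X]

/-- `{z | z i = z j}` is closed (Hausdorff target). [cite: BrockerTomDieck1985, Ch. IV (3.1)] -/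
theorem isClosed_setOf_apply_eq [T2Space X] (i j : ι) : IsClosed {z : ι → X | z i = z j} :=
  isClosed_eq (continuous_apply i) (continuous_apply j)

/-- `{z | z i = z j}` (`i ≠ j`) has EMPTY INTERIOR when `X` has no isolated points: perturb the `i`-th coordinate inside any open set.
[cite: BrockerTomDieck1985, Ch. IV (2.11)] -/
theorem interior_setOf_apply_eq [DecidableEq ι] [PerfectSpace X] {i j : ι} (hij : i ≠ j) : interior {z : ι → X | z i = z j} = ∅ := by
  rw [Set.eq_empty_iff_forall_notMem]
  intro z hz
  rw [mem_interior] at hz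
  obtain ⟨U, hUS, hUo, hzU⟩ := hz
  have hzij : z i = z j := hUS hzU
  -- the `i`-th coordinate slice of `U` through `z` is an open neighbourhood of `z i`
  have hcont : Continuous fun x : X => Function.update z i x := continuous_const.update i continuous_id
  have hV : IsOpen ((fun x : X => Function.update z i x) ⁻¹' U) := hUo.preimage hcont
  have hzi : z i ∈ (fun x : X => Function.update z i x) ⁻¹' U := by
    show Function.update z i (z i) ∈ U
    rw [Function.update_eq_self]
    exact hzU
  -- a point `x ≠ z i` in it (no isolated points)
  have hne : ((fun x : X => Function.update z i x) ⁻¹' U ∩ {z i}ᶜ).Nonempty := by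
    have hmem : (fun x : X => Function.update z i x) ⁻¹' U ∈ 𝓝[≠] (z i) := mem_nhdsWithin_of_mem_nhds (hV.mem_nhds hzi)
    obtain ⟨x, hx⟩ := Filter.nonempty_of_mem (inter_mem hmem self_mem_nhdsWithin)
    exact ⟨x, hx⟩
  obtain ⟨x, hxU, hxne⟩ := hne
  have hx : Function.update z i x ∈ {z : ι → X | z i = z j} := hUS hxU
  simp only [mem_setOf_eq, Function.update_self, Function.update_of_ne hij.symm] at hx
  exact hxne (by rw [mem_singleton_iff, hx, hzij])

/-- `{z | z i ≠ z j}` is dense (`i ≠ j`, no isolated points). [cite: BrockerTomDieck1985, Ch. IV (2.11)] -/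
theorem dense_setOf_apply_ne [DecidableEq ι] [PerfectSpace X] {i j : ι} (hij : i ≠ j) : Dense {z : ι → X | z i ≠ z j} := by
  have h := interior_eq_empty_iff_dense_compl.mp (interior_setOf_apply_eq (X := X) hij)
  convert h using 1
  ext z
  simp only [mem_setOf_eq, mem_compl_iff]

/-- The injective maps form an OPEN set (`ι` finite, `X` Hausdorff). [cite: BrockerTomDieck1985, Ch. IV (3.1)] -/
theorem isOpen_setOf_injective [Finite ι] [T2Space X] : IsOpen {z : ι → X | Injective z} := by
  have h : {z : ι → X | Injective z} = ⋂ p ∈ {p : ι × ι | p.1 ≠ p.2}, {z : ι → X | z p.1 ≠ z p.2} := by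
    ext z
    simp only [mem_setOf_eq, mem_iInter, Prod.forall]
    exact ⟨fun hz a b hab h => hab (hz h), fun hz a b h => by_contra fun hab => hz a b hab h⟩
  rw [h]
  refine Set.Finite.isOpen_biInter (Set.toFinite _) fun p _ => ?_
  exact (isClosed_setOf_apply_eq (X := X) p.1 p.2).isOpen_compl

/-- **THE INJECTIVE MAPS `ι → X` ARE DENSE** (`ι` finite, `X` Hausdorff without isolated points): a finite intersection of open dense sets is dense (no Baire
category needed). [cite: BrockerTomDieck1985, Ch. IV (2.11) «almost every element is general»] -/
theorem dense_setOf_injective [Finite ι] [DecidableEq ι] [T2Space X] [PerfectSpace X] : Dense {z : ι → X | Injective z} := by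
  -- induction over a finite set of «bad pairs»
  have key : ∀ s : Finset (ι × ι), Dense (⋂ p ∈ s, {z : ι → X | p.1 ≠ p.2 → z p.1 ≠ z p.2}) := by
    classical
    intro s
    induction s using Finset.induction_on with
    | empty => simp only [Finset.notMem_empty, iInter_of_empty, iInter_univ]; exact dense_univ
    | insert p s hp ih =>
      rw [Finset.set_biInter_insert]
      refine Dense.inter_of_isOpen_left ?_ ih ?_
      · by_cases h : p.1 = p.2
        · convert dense_univ using 1
          ext z
          simp only [mem_setOf_eq, mem_univ, iff_true]
          exact fun hne => (hne h).elim
        · convert dense_setOf_apply_ne (X := X) h using 1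
          ext z
          simp only [mem_setOf_eq]
          exact ⟨fun hz => hz h, fun hz _ => hz⟩
      · by_cases h : p.1 = p.2
        · convert isOpen_univ using 1
          ext z
          simp only [mem_setOf_eq, mem_univ, iff_true]
          exact fun hne => (hne h).elim
        · convert (isClosed_setOf_apply_eq (X := X) p.1 p.2).isOpen_compl using 1
          ext z
          simp only [mem_setOf_eq, mem_compl_iff]
          exact ⟨fun hz => hz h, fun hz _ => hz⟩
  haveI : Fintype (ι × ι) := Fintype.ofFinite _
  have h := key Finset.univ
  convert h using 1
  ext z
  simp only [mem_setOf_eq, Finset.mem_univ, iInter_true, mem_iInter, Prod.forall]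
  exact ⟨fun hz a b hab h => hab (hz h), fun hz a b h => by_contra fun hab => hz a b hab h⟩

end Literature.Topology

/-! ## §2 The circle has no isolated points -/

namespace Literature.Topology

/-- **`S¹` has no isolated points** (`x · e^{i∕(n+1)} → x` with `e^{i∕(n+1)} ≠ 1`); a THEOREM (use with `haveI`), not an instance. [cite: BrockerTomDieck1985, Ch. IV (2.11)] -/
theorem perfectSpace_circle : PerfectSpace Circle := by
  rw [perfectSpace_iff_forall_not_isolated]
  intro x
  rw [← mem_closure_iff_nhdsWithin_neBot]
  -- the sequence `x · exp(1/(n+1))`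
  have hlim : Tendsto (fun n : ℕ => x * Circle.exp (1 / ((n : ℝ) + 1))) atTop (𝓝 x) := by
    have h1 : Tendsto (fun n : ℕ => (1 : ℝ) / ((n : ℝ) + 1)) atTop (𝓝 0) := tendsto_one_div_add_atTop_nhds_zero_nat
    have h2 : Tendsto (fun n : ℕ => Circle.exp (1 / ((n : ℝ) + 1))) atTop (𝓝 (Circle.exp 0)) :=
      (Circle.exp.continuous.tendsto 0).comp h1
    rw [Circle.exp_zero] at h2
    simpa only [mul_one] using (tendsto_const_nhds (x := x)).mul h2
  refine mem_closure_of_tendsto hlim (Eventually.of_forall fun n => ?_)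
  -- `exp (1/(n+1)) ≠ 1`
  rw [mem_compl_iff, mem_singleton_iff]
  intro h
  have h1 : Circle.exp (1 / ((n : ℝ) + 1)) = 1 := by
    have := congrArg (fun y => x⁻¹ * y) h
    simpa only [inv_mul_cancel_left, inv_mul_cancel] using this
  rw [Circle.exp_eq_one] at h1
  obtain ⟨m, hm⟩ := h1
  have hpos : (0 : ℝ) < 1 / ((n : ℝ) + 1) := by positivity
  have hle : (1 : ℝ) / ((n : ℝ) + 1) ≤ 1 := by
    rw [div_le_one (by positivity)]
    linarith [show (0 : ℝ) ≤ n from n.cast_nonneg]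
  -- `m · 2π ∈ (0, 1]` is impossible for an integer `m`
  rcases lt_trichotomy m 0 with hm0 | hm0 | hm0
  · have : (m : ℝ) * (2 * Real.pi) < 0 := mul_neg_of_neg_of_pos (Int.cast_lt_zero.mpr hm0) Real.two_pi_pos
    linarith
  · rw [hm0, Int.cast_zero, zero_mul] at hm
    linarith
  · have h1m : (1 : ℝ) ≤ m := by exact_mod_cast hm0
    have : (2 * Real.pi : ℝ) ≤ (m : ℝ) * (2 * Real.pi) := le_mul_of_one_le_left Real.two_pi_pos.le h1m
    linarith [Real.pi_gt_three]

/-! ## §3 Families of circle points: placewise injectivity is open-dense -/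

variable {W : Type*} {ι : Type*}

/-- `{z : W → ι → S¹ | ∀ w, z w injective}` is open (`W`, `ι` finite). [cite: BrockerTomDieck1985, Ch. IV (3.1)] -/
theorem isOpen_setOf_forall_injective [Finite W] [Finite ι] : IsOpen {z : W → ι → Circle | ∀ w, Injective (z w)} := by
  have h : {z : W → ι → Circle | ∀ w, Injective (z w)} = ⋂ w, (fun z => z w) ⁻¹' {v : ι → Circle | Injective v} := by
    ext z; simp only [mem_setOf_eq, mem_iInter, mem_preimage]
  rw [h]
  exact isOpen_iInter_of_finite fun w => (isOpen_setOf_injective (X := Circle)).preimage (continuous_apply w)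

/-- **`{z : W → ι → S¹ | ∀ w, z w injective}` IS DENSE** (`W`, `ι` finite): the product of dense open coordinate conditions. [cite: BrockerTomDieck1985, Ch. IV (2.11)] -/
theorem dense_setOf_forall_injective [Finite W] [Finite ι] [DecidableEq ι] : Dense {z : W → ι → Circle | ∀ w, Injective (z w)} := by
  haveI := perfectSpace_circle
  have h : {z : W → ι → Circle | ∀ w, Injective (z w)} = Set.pi univ fun _ => {v : ι → Circle | Injective v} := by
    ext z; simp only [mem_setOf_eq, mem_univ_pi]
  rw [h]
  exact dense_pi univ fun w _ => dense_setOf_injective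

/-- At EVERY family `z₀` (placewise injective or not) the filter `𝓝[{placewise injective}] z₀` is proper. [cite: Rogawski1990, §8.2 p. 122] -/
theorem nhdsWithin_setOf_forall_injective_neBot [Finite W] [Finite ι] [DecidableEq ι] (z₀ : W → ι → Circle) :
    (𝓝[{z : W → ι → Circle | ∀ w, Injective (z w)}] z₀).NeBot := by
  rw [← mem_closure_iff_nhdsWithin_neBot]
  exact dense_setOf_forall_injective z₀

end Literature.Topology

/-! ## §4 On the diagonal torus of `U(diag α)(L⁺ ⊗ ℝ)`: every torus point is a limit of regular torus points -/

section ArchTorus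

open NumberField NumberField.InfinitePlace Literature.Topology

namespace Literature.NumberTheory.Automorphic

namespace UnitaryGroup

variable (L : Type) [Field L] [NumberField L] [IsCMField L] (N : ℕ) (α : Fin N → L)

/-- **THE FILTER «`γ → γ₀` THROUGH REGULAR TORUS POINTS» IS PROPER AT EVERY TORUS POINT** `γ₀ = t(z₀)` of `U(diag α)(L⁺ ⊗ ℝ)` (singular and central points
included): `𝓝[{t(z) | z placewise injective}] (t(z₀)) ≠ ⊥` — the image of §3 under the continuous ★ `archDiagTorus` (placewise injective ⇔ regular, ★
`isRegularElt_archDiagTorus_iff`).  This is what makes the `Tendsto … (𝓝[T_reg] γ₀)` clauses of the limit-formula letters non-vacuous.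
[cite: Rogawski1990, §8.2 p. 122; §14.5 p. 238] [cite: BrockerTomDieck1985, Ch. IV (2.11)] -/
theorem nhdsWithin_regular_archDiagTorus_neBot (z₀ : {w : InfinitePlace L // IsComplex w} → Fin N → Circle) :
    (𝓝[{γ | ∃ z : {w : InfinitePlace L // IsComplex w} → Fin N → Circle, (∀ w, Function.Injective (z w)) ∧ γ = archDiagTorus L N α z}]
      (archDiagTorus L N α z₀)).NeBot := by
  classical
  have hS : {γ | ∃ z : {w : InfinitePlace L // IsComplex w} → Fin N → Circle, (∀ w, Function.Injective (z w)) ∧ γ = archDiagTorus L N α z} =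
      archDiagTorus L N α '' {z | ∀ w, Function.Injective (z w)} := by
    ext γ
    simp only [mem_setOf_eq, mem_image]
    exact ⟨fun ⟨z, hz, h⟩ => ⟨z, hz, h.symm⟩, fun ⟨z, hz, h⟩ => ⟨z, hz, h.symm⟩⟩
  rw [hS]
  haveI := nhdsWithin_setOf_forall_injective_neBot (W := {w : InfinitePlace L // IsComplex w}) (ι := Fin N) z₀
  exact Filter.neBot_of_le
    ((continuous_archDiagTorus L N α).continuousWithinAt.tendsto_nhdsWithin_image (s := {z | ∀ w, Function.Injective (z w)}))

end UnitaryGroup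

end Literature.NumberTheory.Automorphic

end ArchTorus

end
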